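import Mathlib
import Literature.MathematicalPhysics.QuantumLattice.YangMillsClassical
import Literature.MathematicalPhysics.QuantumLattice.GrassmannIntegralProofs
import Summits.QuantumFields.QCD.Theorems.NestedDissectionSeaEarlyCrosserLawStubKatoSobolevCutoff
import Summits.QuantumFields.QCD.Theorems.NestedDissectionSeaEarlyCrosserLawZeroModeRegularity
import Summits.QuantumFields.QCD.Theorems.NestedDissectionSeaEarlyCrosserLawZeroModeDuality
import HarnessLib

/-!
# Zero-mode action floor — lemmas for the assembly (lead c7, line `zero-mode-floor-dilute-gas` of crux
`NestedDissectionSea.EarlyCrosserLaw`, stmt-QuantumFields-13995)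

Helpers for the registered stub `stub_floorAssembly` (file `…StubFloorAssembly.lean`):
* `floor_absorb` — the real arithmetic of the absorption step (choice of `θ, δ, K` from `α < 1`);
* `gUpper_sq`, `gLower_sq` — `(√3·|F^∓|)² = 3(ρ ± 2q)` for the curvature of an anti-Hermitian connection
  (duality identities `duality_norm_sq_add/_sub`, `ymDensityOfBasis_basisFun_eq`);
* `hasCompactSupport_sq_mul`, `hasCompactSupport_normFDeriv_sq_mul` — supports of `χ² f`, `‖dχ‖² f`;
* `spinor_eq_zero_of_covDeriv_eq_zero` — a covariantly constant square-integrable spinor field on `ℝ⁴`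
  vanishes (`d|ψ|² = 2Re⟨ψ,∇ψ⟩ = 0`, constants are not integrable for Lebesgue measure on `ℝ⁴`).
-/

noncomputable section

open scoped BigOperators Matrix ContDiff Matrix.Norms.Frobenius
open MeasureTheory Literature.MathematicalPhysics.QuantumLattice

namespace Summit.QuantumFields.QCD.Cruxes.EarlyCrosserLaw.ZeroModeFloorDiluteGas

/-! ### Real arithmetic of the absorption -/

/-- **Absorption constants.**  If `0 ≤ T`, `0 < s` and `α := T·s·(4/5) < 1`, there are `θ, δ > 0` and
`K ≥ 0` such that the two integral inequalities of the floor argument (`X − I ≤ δX + δ⁻¹E` and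
`I ≤ T s [(1+θ)(4/5) X + (1+θ⁻¹) E]`) force `δ X ≤ K E`. -/
theorem floor_absorb (T s : ℝ) (hT : 0 ≤ T) (hs : 0 < s) (hα : T * s * (4 / 5 : ℝ) < 1) :
    ∃ θ δ K : ℝ, 0 < θ ∧ 0 < δ ∧ 0 ≤ K ∧ ∀ X E I : ℝ,
      X - I ≤ δ * X + δ⁻¹ * E →
      I ≤ T * s * ((1 + θ) * (4 / 5 : ℝ) * X + (1 + θ⁻¹) * E) →
      δ * X ≤ K * E := by
  set α : ℝ := T * s * (4 / 5 : ℝ) with hαdef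
  have hα0 : 0 ≤ α := by rw [hαdef]; positivity
  set θ : ℝ := (1 - α) / 2 with hθdef
  have hθ : 0 < θ := by rw [hθdef]; linarith
  set δ : ℝ := (1 - (1 + θ) * α) / 2 with hδdef
  have hδ : 0 < δ := by
    rw [hδdef, hθdef]
    nlinarith [mul_pos (sub_pos.2 hα) (by linarith : (0 : ℝ) < 2 - α)]
  set K : ℝ := δ⁻¹ + T * s * (1 + θ⁻¹) with hKdef
  have hK : 0 ≤ K := by
    rw [hKdef]
    have : 0 < θ⁻¹ := inv_pos.2 hθ
    have : 0 < δ⁻¹ := inv_pos.2 hδ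
    positivity
  refine ⟨θ, δ, K, hθ, hδ, hK, fun X E I h1 h2 => ?_⟩
  have h2δ : 2 * δ = 1 - (1 + θ) * α := by rw [hδdef]; ring
  have hid : K * E - δ * X = (δ * X + δ⁻¹ * E) - (X - T * s * ((1 + θ) * (4 / 5 : ℝ) * X + (1 + θ⁻¹) * E)) := by
    rw [hKdef]
    linear_combination (-X) * h2δ
  nlinarith [hid, h1, h2]

/-! ### The curvature weights `g₁, g₂` -/

/-- `g₁² = 3(ρ + 2q)`: the anti-self-dual combinations, by the duality identities. -/
theorem gUpper_sq {A : Connection (EuclideanSpace ℝ (Fin 4)) (Matrix (Fin 3) (Fin 3) ℂ)}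
    (hA : IsSmoothConnection A) (hAH : ∀ x v, (A x v)ᴴ = -(A x v)) (x : EuclideanSpace ℝ (Fin 4)) :
    (Real.sqrt 3 * Real.sqrt
        (‖curvature A x (EuclideanSpace.single (0 : Fin 4) (1 : ℝ)) (EuclideanSpace.single (1 : Fin 4) (1 : ℝ))
            - curvature A x (EuclideanSpace.single (2 : Fin 4) (1 : ℝ)) (EuclideanSpace.single (3 : Fin 4) (1 : ℝ))‖ ^ 2
          + ‖curvature A x (EuclideanSpace.single (0 : Fin 4) (1 : ℝ)) (EuclideanSpace.single (2 : Fin 4) (1 : ℝ))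
            + curvature A x (EuclideanSpace.single (1 : Fin 4) (1 : ℝ)) (EuclideanSpace.single (3 : Fin 4) (1 : ℝ))‖ ^ 2
          + ‖curvature A x (EuclideanSpace.single (0 : Fin 4) (1 : ℝ)) (EuclideanSpace.single (3 : Fin 4) (1 : ℝ))
            - curvature A x (EuclideanSpace.single (1 : Fin 4) (1 : ℝ)) (EuclideanSpace.single (2 : Fin 4) (1 : ℝ))‖ ^ 2)) ^ 2
      = 3 * (ymDensityOfBasis (EuclideanSpace.basisFun (Fin 4) ℝ) A x + 2 *
          (((curvature A x (EuclideanSpace.single (0 : Fin 4) (1 : ℝ)) (EuclideanSpace.single (1 : Fin 4) (1 : ℝ)))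
              * (curvature A x (EuclideanSpace.single (2 : Fin 4) (1 : ℝ)) (EuclideanSpace.single (3 : Fin 4) (1 : ℝ)))).trace
            - ((curvature A x (EuclideanSpace.single (0 : Fin 4) (1 : ℝ)) (EuclideanSpace.single (2 : Fin 4) (1 : ℝ)))
              * (curvature A x (EuclideanSpace.single (1 : Fin 4) (1 : ℝ)) (EuclideanSpace.single (3 : Fin 4) (1 : ℝ)))).trace
            + ((curvature A x (EuclideanSpace.single (0 : Fin 4) (1 : ℝ)) (EuclideanSpace.single (3 : Fin 4) (1 : ℝ)))
              * (curvature A x (EuclideanSpace.single (1 : Fin 4) (1 : ℝ)) (EuclideanSpace.single (2 : Fin 4) (1 : ℝ)))).trace).re) := by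
  have hadd := duality_norm_sq_add
    (fun μ ν => curvature A x (EuclideanSpace.single μ (1 : ℝ)) (EuclideanSpace.single ν (1 : ℝ)))
  have hsub := duality_norm_sq_sub
    (fun μ ν => curvature A x (EuclideanSpace.single μ (1 : ℝ)) (EuclideanSpace.single ν (1 : ℝ)))
    (fun μ ν => curvature_conjTranspose hA hAH x _ _)
  beta_reduce at hadd hsub
  rw [ymDensityOfBasis_basisFun_eq A x, mul_pow, Real.sq_sqrt (by norm_num : (0 : ℝ) ≤ 3),
    Real.sq_sqrt (by positivity)]
  linarith [hadd, hsub]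

/-- `g₂² = 3(ρ − 2q)`: the self-dual combinations, by the duality identities. -/
theorem gLower_sq {A : Connection (EuclideanSpace ℝ (Fin 4)) (Matrix (Fin 3) (Fin 3) ℂ)}
    (hA : IsSmoothConnection A) (hAH : ∀ x v, (A x v)ᴴ = -(A x v)) (x : EuclideanSpace ℝ (Fin 4)) :
    (Real.sqrt 3 * Real.sqrt
        (‖curvature A x (EuclideanSpace.single (0 : Fin 4) (1 : ℝ)) (EuclideanSpace.single (1 : Fin 4) (1 : ℝ))
            + curvature A x (EuclideanSpace.single (2 : Fin 4) (1 : ℝ)) (EuclideanSpace.single (3 : Fin 4) (1 : ℝ))‖ ^ 2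
          + ‖curvature A x (EuclideanSpace.single (0 : Fin 4) (1 : ℝ)) (EuclideanSpace.single (2 : Fin 4) (1 : ℝ))
            - curvature A x (EuclideanSpace.single (1 : Fin 4) (1 : ℝ)) (EuclideanSpace.single (3 : Fin 4) (1 : ℝ))‖ ^ 2
          + ‖curvature A x (EuclideanSpace.single (0 : Fin 4) (1 : ℝ)) (EuclideanSpace.single (3 : Fin 4) (1 : ℝ))
            + curvature A x (EuclideanSpace.single (1 : Fin 4) (1 : ℝ)) (EuclideanSpace.single (2 : Fin 4) (1 : ℝ))‖ ^ 2)) ^ 2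
      = 3 * (ymDensityOfBasis (EuclideanSpace.basisFun (Fin 4) ℝ) A x - 2 *
          (((curvature A x (EuclideanSpace.single (0 : Fin 4) (1 : ℝ)) (EuclideanSpace.single (1 : Fin 4) (1 : ℝ)))
              * (curvature A x (EuclideanSpace.single (2 : Fin 4) (1 : ℝ)) (EuclideanSpace.single (3 : Fin 4) (1 : ℝ)))).trace
            - ((curvature A x (EuclideanSpace.single (0 : Fin 4) (1 : ℝ)) (EuclideanSpace.single (2 : Fin 4) (1 : ℝ)))
              * (curvature A x (EuclideanSpace.single (1 : Fin 4) (1 : ℝ)) (EuclideanSpace.single (3 : Fin 4) (1 : ℝ)))).trace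
            + ((curvature A x (EuclideanSpace.single (0 : Fin 4) (1 : ℝ)) (EuclideanSpace.single (3 : Fin 4) (1 : ℝ)))
              * (curvature A x (EuclideanSpace.single (1 : Fin 4) (1 : ℝ)) (EuclideanSpace.single (2 : Fin 4) (1 : ℝ)))).trace).re) := by
  have hadd := duality_norm_sq_add
    (fun μ ν => curvature A x (EuclideanSpace.single μ (1 : ℝ)) (EuclideanSpace.single ν (1 : ℝ)))
  have hsub := duality_norm_sq_sub
    (fun μ ν => curvature A x (EuclideanSpace.single μ (1 : ℝ)) (EuclideanSpace.single ν (1 : ℝ)))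
    (fun μ ν => curvature_conjTranspose hA hAH x _ _)
  beta_reduce at hadd hsub
  rw [ymDensityOfBasis_basisFun_eq A x, mul_pow, Real.sq_sqrt (by norm_num : (0 : ℝ) ≤ 3),
    Real.sq_sqrt (by positivity)]
  linarith [hadd, hsub]


/-! ### Small support lemmas -/

/-- `χ² f` has compact support when `χ` has. -/
theorem hasCompactSupport_sq_mul {χ : EuclideanSpace ℝ (Fin 4) → ℝ} (hχs : HasCompactSupport χ)
    (f : EuclideanSpace ℝ (Fin 4) → ℝ) : HasCompactSupport fun x => χ x ^ 2 * f x := by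
  have : (fun x => χ x ^ 2 * f x) = fun x => χ x * (χ x * f x) := funext fun x => by ring
  rw [this]; exact hχs.mul_right

/-- `‖dχ‖² f` has compact support when `χ` has. -/
theorem hasCompactSupport_normFDeriv_sq_mul {χ : EuclideanSpace ℝ (Fin 4) → ℝ} (hχs : HasCompactSupport χ)
    (f : EuclideanSpace ℝ (Fin 4) → ℝ) : HasCompactSupport fun x => ‖fderiv ℝ χ x‖ ^ 2 * f x := by
  have h1 : HasCompactSupport fun x => ‖fderiv ℝ χ x‖ := (hχs.fderiv (𝕜 := ℝ)).norm
  have : (fun x => ‖fderiv ℝ χ x‖ ^ 2 * f x) = fun x => ‖fderiv ℝ χ x‖ * (‖fderiv ℝ χ x‖ * f x) :=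
    funext fun x => by ring
  rw [this]; exact h1.mul_right

/-! ### Covariantly constant integrable spinors vanish -/

/-- **A covariantly constant, square-integrable spinor field on `ℝ⁴` vanishes.**  If all covariant
derivatives `∂_μψ + A_μψ` of a smooth spinor field along a pointwise anti-Hermitian connection vanish,
then `|ψ|²` has zero derivative (`d|ψ|² = 2Re⟨ψ, ∂ψ⟩ = 2Re⟨ψ, ∇ψ⟩`), hence is constant; a nonzero
constant is not integrable on `ℝ⁴` (infinite Lebesgue measure). -/
theorem spinor_eq_zero_of_covDeriv_eq_zero
    (A : Connection (EuclideanSpace ℝ (Fin 4)) (Matrix (Fin 3) (Fin 3) ℂ))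
    (ψ : EuclideanSpace ℝ (Fin 4) → Fin 4 → Fin 3 → ℂ)
    (hAH : ∀ x v, (A x v)ᴴ = -(A x v)) (hψ : ContDiff ℝ ∞ ψ)
    (hcov : ∀ (x : EuclideanSpace ℝ (Fin 4)) (μ : Fin 4) (s : Fin 4) (c : Fin 3),
      fderiv ℝ (fun z => ψ z s c) x (EuclideanSpace.single μ (1 : ℝ)) +
        ∑ c' : Fin 3, A x (EuclideanSpace.single μ (1 : ℝ)) c c' * ψ x s c' = 0)
    (hint : Integrable (fun x => ∑ s, ∑ c, ‖ψ x s c‖ ^ 2)) :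
    ∀ x, ψ x = 0 := by
  have hdAt : ∀ (x : EuclideanSpace ℝ (Fin 4)) (s : Fin 4) (c : Fin 3), DifferentiableAt ℝ (fun y => ψ y s c) x :=
    fun x s c => ((contDiff_spinor_component hψ s c).differentiable (by simp)).differentiableAt
  have hdiff : Differentiable ℝ (fun x => ∑ s, ∑ c, ‖ψ x s c‖ ^ 2) := fun x =>
    (katoSobolev_hasFDerivAt_normSq ψ x (hdAt x)).differentiableAt
  have hfd0 : ∀ x, fderiv ℝ (fun x => ∑ s, ∑ c, ‖ψ x s c‖ ^ 2) x = 0 := by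
    intro x
    have hμ : ∀ μ : Fin 4, fderiv ℝ (fun y => ∑ s, ∑ c, ‖ψ y s c‖ ^ 2) x (EuclideanSpace.single μ (1 : ℝ)) = 0 := by
      intro μ
      rw [(katoSobolev_hasFDerivAt_normSq ψ x (hdAt x)).fderiv]
      rw [katoSobolev_normSq_deriv_apply]
      rw [katoSobolev_re_partial_eq_re_cov (A x (EuclideanSpace.single μ (1 : ℝ))) (hAH x _) (ψ x)
        (fun s c => fderiv ℝ (fun y => ψ y s c) x (EuclideanSpace.single μ (1 : ℝ)))]
      simp only [hcov x μ, mul_zero, Finset.sum_const_zero, Complex.zero_re]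
    refine ContinuousLinearMap.coe_injective ((EuclideanSpace.basisFun (Fin 4) ℝ).toBasis.ext fun μ => ?_)
    simp only [ContinuousLinearMap.coe_coe, OrthonormalBasis.coe_toBasis, EuclideanSpace.basisFun_apply,
      ContinuousLinearMap.toLinearMap_zero, LinearMap.zero_apply]
    exact hμ μ
  intro x₁
  by_contra hx₁
  have hconst : ∀ y, (∑ s, ∑ c, ‖ψ y s c‖ ^ 2) = ∑ s, ∑ c, ‖ψ x₁ s c‖ ^ 2 := fun y =>
    is_const_of_fderiv_eq_zero hdiff hfd0 y x₁
  have hnx₁ : 0 < ∑ s, ∑ c, ‖ψ x₁ s c‖ ^ 2 := by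
    have hex : ∃ s c, ψ x₁ s c ≠ 0 := by
      by_contra hall
      push Not at hall
      exact hx₁ (funext fun s => funext fun c => hall s c)
    obtain ⟨s, c, hsc⟩ := hex
    have h1 : ‖ψ x₁ s c‖ ^ 2 ≤ ∑ s, ∑ c, ‖ψ x₁ s c‖ ^ 2 :=
      le_trans
        (Finset.single_le_sum (f := fun c => ‖ψ x₁ s c‖ ^ 2) (fun c _ => sq_nonneg _) (Finset.mem_univ c))
        (Finset.single_le_sum (f := fun s => ∑ c, ‖ψ x₁ s c‖ ^ 2)
          (fun s _ => Finset.sum_nonneg fun c _ => sq_nonneg _) (Finset.mem_univ s))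
    have h2 : 0 < ‖ψ x₁ s c‖ ^ 2 := pow_pos (norm_pos_iff.2 hsc) 2
    linarith
  have hnconst : (fun x => ∑ s, ∑ c, ‖ψ x s c‖ ^ 2) = fun _ => ∑ s, ∑ c, ‖ψ x₁ s c‖ ^ 2 := funext hconst
  rw [hnconst] at hint
  have hfin : IsFiniteMeasure (volume : Measure (EuclideanSpace ℝ (Fin 4))) :=
    (integrable_const_iff.1 hint).resolve_left hnx₁.ne'
  have htop := measure_univ_of_isAddLeftInvariant (volume : Measure (EuclideanSpace ℝ (Fin 4)))
  exact absurd htop (measure_lt_top volume Set.univ).ne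

end Summit.QuantumFields.QCD.Cruxes.EarlyCrosserLaw.ZeroModeFloorDiluteGas

end
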